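import Literature.NumberTheory.EllipticCurves.ZpExtensionDescentProofs
import HarnessLib

/-!
# Relative descent of `γ`-invariant classes along a procyclic step `N ⊴ H` inside `Γ_K`
# (inflation–restriction surjectivity `H¹(H, M) ↠ H¹(N, M)^γ` and the finiteness of its kernel,
# finite `p`-torsion coefficients) — the second floor of the `ℤ_p²`-tower

PROOFS-ONLY sibling of `ZpExtensionDescentProofs` (no definition, no named fact, no `sorry`, no instance).
Cell `bsd-2adic` (`run/shared/lean/pub/bsd-2adic/`), seat `bsd-2adic-tower-1` GEN 46; arithmetic input of
«COFGEN₂» (finite generation of `X_Gr(E/K̃_∞)` over `Λ₂`, O2 stmt-BirchSwinnertonDyer-24728 line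
`two_variable_gv_squeeze_two`, stub R0T).

`ZpExtensionDescentProofs` proves Greenberg's Lemma 3.2 (LNM 1716 §3 p. 86: "`Γ_n ≅ ℤ_p` is a free
pro-`p` group. Hence `H²(Γ_n, B) = 0`. Thus `h_n` is surjective") for the kernel `N = ker κ` of a
`ℤ_p`-extension of the BASE field `K`: every `γ`-invariant class of `H¹(K_∞, M)` is a restriction from
`H¹(K, M)`. Over the `ℤ_p²`-tower `K̃_∞ = K̄^{ker κ₁ ⊓ ker κ₂}` (Rubin 1991 §4; the tree's
`ZpExtension.pairKer`) the quotient `Gal(K̃_∞/K) ≅ ℤ_p²` has cohomological dimension `2` and the direct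
descent to `K` FAILS; but `K̃_∞ / K_∞^{(1)}` is again procyclic (generated by `γ₂ ∈ ker κ₁`), so the
descent goes in two procyclic stages. This file supplies the RELATIVE stage, for an arbitrary closed
subgroup `H ≤ Γ_K` (`= Gal(K̄/K_∞^{(1)})`, an infinite extension — so the base is no longer a number field)
and `N = H ⊓ ker κ` (`= pairKer`), `γ ∈ H` with `κ γ = 1`:

* §1 `subgroup_eq_top_of_isClosed`: a CLOSED subgroup of `H` containing `N` and `γ` is all of `H`
  (`κ(H) ⊆ ℤ_p` is closed and contains `ℕ·1`, dense by `PadicInt.denseRange_natCast`).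
* §2 the level structure inside `H` for an open normal `U ⊴ Γ_K`: `H = ⋃_{k<t} γᵏ (N ⊓ H)(U ⊓ H)`,
  `t = ord(γ mod (N ⊔ U) ⊓ H)` (`exists_decomp_subgroupOf`), and `pᵇ ∣ t` when `U ≤ κ⁻¹(pᵇℤ_p)`
  (`pow_dvd_orderOf_subgroupOf`).
* §3 **`exists_resOfLe_eq_of_conjH1_eq`**: for `M` finite discrete with open stabilisers and `p M = 0`,
  every `x ∈ H¹(N, M)` with `conj_γ x = x` is `res_{N ≤ H} y` for some `y ∈ H¹(H, M)` — the algebraic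
  extension `ĉ(γᵏ n u) = s_k + γᵏ c(n)` of `ZpExtensionDescentProofs` (its generic §`Ext`, REUSED
  verbatim over the group `↥H`), the obstruction killed one `p`-power level deeper exactly as there.
* §4 **`finite_setOf_resOfLe_eq_zero`**: the kernel of `res : H¹(H, M) → H¹(N, M)` is finite — a class
  dying on `N` is represented by a cocycle `δ` with `δ|_N = ∂b|_N`; `δ − ∂b` is then determined by its
  value at `γ` (the zero set of a crossed homomorphism vanishing on `N` and at `γ` is a closed subgroup,
  hence `H` by §1), so the kernel injects into `M` (`= H¹(H/N, M^N) ↪ M^N/(γ−1)`, Serre I.§2.6 (b)).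

## References
* [GreenbergLNM1716] R. Greenberg, *Iwasawa theory for elliptic curves*, LNM 1716 (1999), §3 Lemmas
  3.1–3.2 (p. 86), §1 p. 60.
* [Rubin1991] K. Rubin, Invent. Math. 103 (1991), §4 p. 36 (`Gal(K_∞/K₀) ≅ ℤ_p²`).
* [SerreGaloisCohomology1997] J.-P. Serre, *Galois Cohomology*, I.§2.6 (b) (inflation–restriction).
* [Washington1997] L. Washington, *Introduction to Cyclotomic Fields*, §13.1 (layers of a `ℤ_p`-extension).
-/

open Literature.NumberTheory.EllipticCurves Literature.NumberTheory.GaloisRepresentations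

namespace Literature.NumberTheory.EllipticCurves

namespace ZpDescent

section Relative

open scoped Pointwise

universe u

variable {K : Type u} [Field K] [NumberField K] {p : ℕ} [Fact p.Prime] (κ : ZpExtension K p)
  {H N : Subgroup (Field.absoluteGaloisGroup K)} {γ : Field.absoluteGaloisGroup K}

/-! ### §1. Closed subgroups of `H` containing `N = H ⊓ ker κ` and `γ` -/

/-- **A closed subgroup `O ≤ H` containing `N = H ⊓ ker κ` and `γ` (`κ γ = 1`) is all of `H`.** The image
`κ(O) ⊆ ℤ_p` is compact, hence closed, and contains `κ(γⁿ) = n` for all `n ∈ ℕ`, a dense set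
(`PadicInt.denseRange_natCast`); so `κ(O) = ℤ_p ⊇ κ(H)` and `O ⊇ O·N = H`. (The relative form of the
tree's `ZpExtension.eq_top_of_isOpen_of_kerSubgroup_le`.) [cite: Washington1997, §13.1] -/
theorem subgroup_eq_top_of_isClosed (hH : IsClosed (H : Set (Field.absoluteGaloisGroup K)))
    (hN : ∀ g ∈ H, κ g = 1 → g ∈ N) (hγH : γ ∈ H) (hγ : κ.IsTopGenerator γ)
    (O : Subgroup H) (hO : IsClosed (O : Set H)) (hNO : N.subgroupOf H ≤ O)
    (hγO : (⟨γ, hγH⟩ : H) ∈ O) : O = ⊤ := by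
  haveI : CompactSpace H := isCompact_iff_compactSpace.mp hH.isCompact
  let f : H → ℤ_[p] := fun h ↦ (κ (h : Field.absoluteGaloisGroup K)).toAdd
  have hf : Continuous f :=
    continuous_toAdd.comp ((map_continuous κ).comp continuous_subtype_val)
  have hS : IsClosed (f '' (O : Set H)) := (hO.isCompact.image hf).isClosed
  have hZ : Set.range (Nat.cast : ℕ → ℤ_[p]) ⊆ f '' (O : Set H) := by
    rintro _ ⟨n, rfl⟩
    refine ⟨(⟨γ, hγH⟩ : H) ^ n, O.pow_mem hγO n, ?_⟩
    change (κ (((⟨γ, hγH⟩ : H) ^ n : H) : Field.absoluteGaloisGroup K)).toAdd = (n : ℤ_[p])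
    rw [SubgroupClass.coe_pow, map_pow, show κ γ = Multiplicative.ofAdd 1 from hγ, ← ofAdd_nsmul,
      toAdd_ofAdd, nsmul_eq_mul, mul_one]
  have huniv : f '' (O : Set H) = Set.univ := by
    rw [← hS.closure_eq]
    exact ((PadicInt.denseRange_natCast (p := p)).mono hZ).closure_eq
  rw [eq_top_iff]
  intro h _
  obtain ⟨o, ho, hfo⟩ : f h ∈ f '' (O : Set H) := by rw [huniv]; exact Set.mem_univ _
  have hκ : κ (o : Field.absoluteGaloisGroup K) = κ (h : Field.absoluteGaloisGroup K) :=
    Multiplicative.toAdd.injective hfo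
  have hmem : ((o⁻¹ * h : H) : Field.absoluteGaloisGroup K) ∈ N := by
    refine hN _ (o⁻¹ * h).2 ?_
    rw [Subgroup.coe_mul, Subgroup.coe_inv, map_mul, map_inv, hκ, inv_mul_cancel]
  have hmem' : o⁻¹ * h ∈ O := hNO (Subgroup.mem_subgroupOf.mpr hmem)
  have := O.mul_mem ho hmem'
  rwa [mul_inv_cancel_left] at this

/-! ### §2. The level structure of `H` relative to `N` -/

omit [NumberField K] in
/-- Elements of `N' ⊔ U'` (`N'` normal) factor as `n u` — in the subgroup `H`. [folklore] -/
private theorem exists_eq_mul_of_mem_sup_subgroupOf [N.Normal] (U : Subgroup (Field.absoluteGaloisGroup K))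
    {g : H} (hg : g ∈ N.subgroupOf H ⊔ U.subgroupOf H) :
    ∃ n ∈ N.subgroupOf H, ∃ u ∈ U.subgroupOf H, g = n * u := by
  have : (g : H) ∈ ((N.subgroupOf H ⊔ U.subgroupOf H : Subgroup H) : Set H) := hg
  rw [Subgroup.normal_mul] at this
  obtain ⟨n, hn, u, hu, rfl⟩ := Set.mem_mul.mp this
  exact ⟨n, hn, u, hu, rfl⟩

omit [NumberField K] in
/-- `U ⊓ H` is open in `H` for `U` open in `Γ_K`. [folklore] -/
private theorem isOpen_subgroupOf (U : Subgroup (Field.absoluteGaloisGroup K))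
    (hU : IsOpen (U : Set (Field.absoluteGaloisGroup K))) : IsOpen ((U.subgroupOf H : Subgroup H) : Set H) := by
  rw [Subgroup.coe_subgroupOf]
  exact hU.preimage continuous_subtype_val

/-- **`H = ⋃_{k<t} γᵏ N' U'`** (`N' = N ⊓ H`, `U' = U ⊓ H`, `t = ord(γ mod N'U') > 0`): `⟨γ⟩ N' U'` is an
open — hence closed — subgroup of `H` containing `N'` and `γ`, so it is `H` (§1), and exponents reduce
modulo `t`. The relative form of `exists_decomp`. [cite: Washington1997, §13.1] -/
theorem exists_decomp_subgroupOf [N.Normal] (hH : IsClosed (H : Set (Field.absoluteGaloisGroup K)))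
    (hN : ∀ g ∈ H, κ g = 1 → g ∈ N) (hγH : γ ∈ H) (hγ : κ.IsTopGenerator γ)
    (U : Subgroup (Field.absoluteGaloisGroup K)) [U.Normal]
    (hU : IsOpen (U : Set (Field.absoluteGaloisGroup K))) (g : H) :
    0 < orderOf (QuotientGroup.mk (s := N.subgroupOf H ⊔ U.subgroupOf H) (⟨γ, hγH⟩ : H)) ∧
    ∃ k < orderOf (QuotientGroup.mk (s := N.subgroupOf H ⊔ U.subgroupOf H) (⟨γ, hγH⟩ : H)),
      ∃ n ∈ N.subgroupOf H, ∃ u ∈ U.subgroupOf H, g = (⟨γ, hγH⟩ : H) ^ k * n * u := by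
  haveI : CompactSpace H := isCompact_iff_compactSpace.mp hH.isCompact
  set γ' : H := ⟨γ, hγH⟩ with hγ'
  set L : Subgroup H := N.subgroupOf H ⊔ U.subgroupOf H with hL
  have hLopen : IsOpen (L : Set H) :=
    Subgroup.isOpen_mono (le_sup_right : U.subgroupOf H ≤ L) (isOpen_subgroupOf U hU)
  haveI : Finite (H ⧸ L) := Subgroup.quotient_finite_of_isOpen _ hLopen
  have htpos : 0 < orderOf (QuotientGroup.mk (s := L) γ') := orderOf_pos _
  refine ⟨htpos, ?_⟩
  -- `⟨γ⟩ L = H`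
  have htop : Subgroup.zpowers γ' ⊔ L = ⊤ := by
    refine subgroup_eq_top_of_isClosed κ hH hN hγH hγ _ ?_ ?_ ?_
    · exact Subgroup.isClosed_of_isOpen _ (Subgroup.isOpen_mono (le_sup_right : L ≤ _) hLopen)
    · exact (le_sup_left.trans le_sup_right : N.subgroupOf H ≤ Subgroup.zpowers γ' ⊔ L)
    · exact Subgroup.mem_sup_left (Subgroup.mem_zpowers γ')
  have hg : g ∈ Subgroup.zpowers γ' ⊔ L := htop ▸ Subgroup.mem_top g
  have hg' : (g : H) ∈ ((Subgroup.zpowers γ' ⊔ L : Subgroup H) : Set H) := hg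
  rw [Subgroup.mul_normal] at hg'
  obtain ⟨a, ha, l, hl, rfl⟩ := Set.mem_mul.mp hg'
  obtain ⟨z, rfl⟩ := Subgroup.mem_zpowers_iff.mp ha
  -- reduce the exponent modulo `t`
  set t := orderOf (QuotientGroup.mk (s := L) γ') with ht
  set k := (z % (t : ℤ)).toNat with hk
  have hk0 : 0 ≤ z % (t : ℤ) := Int.emod_nonneg _ (by exact_mod_cast htpos.ne')
  have hklt : k < t := (Int.toNat_lt' htpos).mpr (Int.emod_lt_of_pos _ (by exact_mod_cast htpos))
  have hzk : (QuotientGroup.mk (γ' ^ z) : H ⧸ L) = QuotientGroup.mk (γ' ^ k) := by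
    rw [QuotientGroup.mk_zpow, QuotientGroup.mk_pow, ← zpow_natCast, hk, Int.toNat_of_nonneg hk0, ht,
      zpow_mod_orderOf]
  obtain ⟨l', hl'L, e⟩ : ∃ l' ∈ L, γ' ^ z = γ' ^ k * l' := by
    have := QuotientGroup.eq.mp hzk.symm
    exact ⟨(γ' ^ k)⁻¹ * γ' ^ z, this, by group⟩
  obtain ⟨n, hn, u, hu, hnu⟩ := exists_eq_mul_of_mem_sup_subgroupOf U (L.mul_mem hl'L hl)
  exact ⟨k, hklt, n, hn, u, hu, by rw [e, mul_assoc, hnu, mul_assoc]⟩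

omit [NumberField K] in
/-- If `U ≤ κ⁻¹(pᵇ ℤ_p)` then `pᵇ ∣ t = ord(γ mod N'U')`: `γᵗ = n u` gives `t = κ(γᵗ) = κ(u) ∈ pᵇ ℤ_p`
(`κ(N) = 1`). The relative form of `pow_dvd_levelOrder` (the layers `K_n` of a `ℤ_p`-extension have
`[K_n : K] = pⁿ`). [cite: Washington1997, §13.1] -/
theorem pow_dvd_orderOf_subgroupOf [N.Normal] (hN' : ∀ g ∈ N, κ g = 1) (hγH : γ ∈ H)
    (hγ : κ.IsTopGenerator γ) (U : Subgroup (Field.absoluteGaloisGroup K)) [U.Normal] {b : ℕ}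
    (hUb : U ≤ κ.layerSubgroup b) :
    p ^ b ∣ orderOf (QuotientGroup.mk (s := N.subgroupOf H ⊔ U.subgroupOf H) (⟨γ, hγH⟩ : H)) := by
  set γ' : H := ⟨γ, hγH⟩ with hγ'
  set t := orderOf (QuotientGroup.mk (s := N.subgroupOf H ⊔ U.subgroupOf H) γ') with ht
  have hmem : γ' ^ t ∈ N.subgroupOf H ⊔ U.subgroupOf H := by
    rw [← QuotientGroup.eq_one_iff, QuotientGroup.mk_pow, ht]
    exact pow_orderOf_eq_one _
  obtain ⟨n, hn, u, hu, e⟩ := exists_eq_mul_of_mem_sup_subgroupOf U hmem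
  rw [Subgroup.mem_subgroupOf] at hn hu
  have hκt : (κ ((γ' ^ t : H) : Field.absoluteGaloisGroup K)).toAdd = (t : ℤ_[p]) := by
    rw [SubgroupClass.coe_pow, map_pow, show κ γ = Multiplicative.ofAdd 1 from hγ, ← ofAdd_nsmul,
      toAdd_ofAdd, nsmul_eq_mul, mul_one]
  have hκu : κ ((γ' ^ t : H) : Field.absoluteGaloisGroup K) = κ (u : Field.absoluteGaloisGroup K) := by
    rw [e, Subgroup.coe_mul, map_mul, hN' _ hn, one_mul]
  have h := ZpExtension.mem_layerSubgroup.mp (hUb hu)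
  rw [← hκu, hκt] at h
  have h' : (p : ℤ_[p]) ^ b ∣ ((t : ℤ) : ℤ_[p]) := by exact_mod_cast h
  rw [PadicInt.pow_p_dvd_int_iff] at h'
  exact_mod_cast h'

/-! ### §3. The relative descent theorem -/

variable (M : Type u) [AddCommGroup M] [DistribMulAction (Field.absoluteGaloisGroup K) M]
  [TopologicalSpace M] [DiscreteTopology M]

variable {M}

/-- **Relative descent of `γ`-invariant classes along a procyclic step.** Let `H ≤ Γ_K` be closed,
`κ` a `ℤ_p`-extension of `K`, `N = H ⊓ ker κ` normal in `Γ_K` (stated as: `N ≤ H`, `κ(N) = 1`, and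
`h ∈ H`, `κ h = 1 ⇒ h ∈ N`), `γ ∈ H` with `κ γ = 1`, and `M` a finite discrete `Γ_K`-module with open
stabilisers and `p • M = 0`. Then every `x ∈ H¹(N, M)` with `conj_γ x = x` is `res_{N ≤ H} y` for some
`y ∈ H¹(H, M)`: the restriction `H¹(H, M) → H¹(N, M)^{⟨γ⟩}` is onto, because `H/N ≅ ℤ_p` is free pro-`p`
(Greenberg, LNM 1716, §3 Lemma 3.2, "`H²(Γ_n, B) = 0`. Thus `h_n` is surjective" — there over the base
field; here over ANY closed `H`, e.g. `Gal(K̄/K_∞^{(1)})` with `N = Gal(K̄/K̃_∞)` the `ℤ_p²`-tower).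
Proved `H²`-free with the algebraic extension of `ZpExtensionDescentProofs` run inside `↥H`.
[cite: GreenbergLNM1716, §3 Lemma 3.2] [cite: SerreGaloisCohomology1997, I.§2.6 (b)] -/
theorem exists_resOfLe_eq_of_conjH1_eq [Finite M] [N.Normal]
    (hH : IsClosed (H : Set (Field.absoluteGaloisGroup K))) (hNH : N ≤ H)
    (hN : ∀ g ∈ H, κ g = 1 → g ∈ N) (hN' : ∀ g ∈ N, κ g = 1)
    (hγH : γ ∈ H) (hγ : κ.IsTopGenerator γ)
    (hstab : ∀ v : M, IsOpen ((MulAction.stabilizer (Field.absoluteGaloisGroup K) v : Subgroup _) :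
      Set (Field.absoluteGaloisGroup K)))
    (hpM : ∀ v : M, p • v = 0) (x : subgroupH1 N M) (hx : conjH1 N M γ x = x) :
    ∃ y : subgroupH1 H M, resOfLe M hNH y = x := by
  classical
  have hp := (Fact.out : p.Prime)
  haveI : CompactSpace H := isCompact_iff_compactSpace.mp hH.isCompact
  set γ' : H := ⟨γ, hγH⟩ with hγ'def
  set N' : Subgroup H := N.subgroupOf H with hN'def
  obtain ⟨φ, rfl⟩ := oneCocycleClass_surjective _ x
  -- the cocycle as a function on `↥H`
  let c : H → M := fun g ↦ if hg : (g : Field.absoluteGaloisGroup K) ∈ N then φ.1 ⟨g, hg⟩ else 0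
  have hcN : ∀ (g : H) (hg : (g : Field.absoluteGaloisGroup K) ∈ N), c g = φ.1 ⟨g, hg⟩ :=
    fun g hg ↦ dif_pos hg
  have hc : IsCocycleOn N' c := by
    intro h hh h' hh'
    rw [hN'def, Subgroup.mem_subgroupOf] at hh hh'
    rw [hcN _ (N.mul_mem hh hh'), hcN _ hh, hcN _ hh']
    exact φ.2 ⟨h, hh⟩ ⟨h', hh'⟩
  -- (⋆) from `γ`-invariance
  have hconjφ : conjH1 N M γ (oneCocycleClass _ φ) = oneCocycleClass _
      (contOneCocycles.pullback (subgroupConj N γ)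
        (resHomOfEquivariant (subgroupConj N γ) (DistribSMul.toAddMonoidHom M γ) (fun x m ↦ by
          simp only [DistribSMul.toAddMonoidHom_apply, Subgroup.smul_def, subgroupConj_apply_coe,
            smul_smul, mul_assoc, mul_inv_cancel_left])) φ) :=
    map_oneCocycleClass _ _ _ φ
  rw [hconjφ, ← sub_eq_zero, ← oneCocycleClass_sub, oneCocycleClass_eq_zero_iff] at hx
  obtain ⟨m, hm⟩ := hx
  have hstar : ∀ h ∈ N', conjTwist γ' c h = c h + cob m h := by
    intro h hh
    rw [hN'def, Subgroup.mem_subgroupOf] at hh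
    have := hm ⟨h, hh⟩
    rw [Submodule.coe_sub, ContinuousMap.sub_apply, contOneCocycles.pullback_apply] at this
    change γ • φ.1 (subgroupConj N γ ⟨h, hh⟩) - φ.1 ⟨h, hh⟩ = (h : Field.absoluteGaloisGroup K) • m - m
      at this
    have hconj : ((γ'⁻¹ * h * γ' : H) : Field.absoluteGaloisGroup K) ∈ N := by
      have := Subgroup.Normal.conj_mem inferInstance (h : Field.absoluteGaloisGroup K) hh γ⁻¹
      simpa using this
    rw [conjTwist_apply, cob_apply, hcN _ hh, hcN _ hconj]
    rw [sub_eq_iff_eq_add'] at this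
    exact this
  -- `U₀`: open normal in `Γ_K`, fixing `M` pointwise and killing `φ` near `1`
  have hzero : IsOpen {h : N | φ.1 h = 0} :=
    (isOpen_discrete ({0} : Set M)).preimage φ.1.continuous
  obtain ⟨O, hO, hOeq⟩ := isOpen_induced_iff.mp hzero
  have h1O : (1 : Field.absoluteGaloisGroup K) ∈ O := by
    have : (1 : N) ∈ Subtype.val ⁻¹' O := by rw [hOeq]; exact contOneCocycles.apply_one φ
    exact this
  obtain ⟨U₀, hU₀⟩ := ProfiniteGrp.exist_openNormalSubgroup_sub_open_nhds_of_one
    ((isOpen_fixator M hstab).inter hO) ⟨fun v ↦ one_smul _ v, h1O⟩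
  have hUM₀ : ∀ u ∈ U₀.toSubgroup, ∀ v : M, u • v = v := fun u hu v ↦ (hU₀ hu).1 v
  have hUφ₀ : ∀ (g : Field.absoluteGaloisGroup K) (hg : g ∈ N), g ∈ U₀.toSubgroup → φ.1 ⟨g, hg⟩ = 0 :=
    fun g hg hgU ↦ by
    have : (⟨g, hg⟩ : N) ∈ Subtype.val ⁻¹' O := (hU₀ hgU).2
    rw [hOeq] at this
    exact this
  -- the level `U₀` inside `H`
  set U₀' : Subgroup H := U₀.toSubgroup.subgroupOf H with hU₀'def
  have hUM₀' : ∀ u ∈ U₀', ∀ w : M, u • w = w := fun u hu w ↦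
    hUM₀ _ (Subgroup.mem_subgroupOf.mp hu) w
  have hUc₀ : ∀ x ∈ N', x ∈ U₀' → c x = 0 := fun x hx hxU ↦ by
    rw [hN'def, Subgroup.mem_subgroupOf] at hx
    rw [hcN _ hx]
    exact hUφ₀ _ hx (Subgroup.mem_subgroupOf.mp hxU)
  set t₀ := orderOf (QuotientGroup.mk (s := N' ⊔ U₀') γ') with ht₀def
  have ht₀pos : 0 < t₀ := (exists_decomp_subgroupOf κ hH hN hγH hγ U₀.toSubgroup U₀.isOpen 1).1
  -- the level `U := U₀ ∩ κ⁻¹(p^{v+1} ℤ_p)`, `p^v ‖ t₀`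
  obtain ⟨v, t₀', ht₀', ht₀⟩ := Nat.exists_eq_pow_mul_and_not_dvd ht₀pos.ne' p hp.ne_one
  let U : Subgroup (Field.absoluteGaloisGroup K) := U₀.toSubgroup ⊓ κ.layerSubgroup (v + 1)
  haveI : U.Normal := Subgroup.normal_inf_normal _ _
  have hUopen : IsOpen (U : Set (Field.absoluteGaloisGroup K)) :=
    U₀.isOpen.inter (κ.isOpen_layerSubgroup (v + 1))
  set U' : Subgroup H := U.subgroupOf H with hU'def
  have hU'open : IsOpen (U' : Set H) := isOpen_subgroupOf U hUopen
  have hUM : ∀ u ∈ U', ∀ w : M, u • w = w := fun u hu w ↦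
    hUM₀ _ (Subgroup.mem_subgroupOf.mp hu).1 w
  have hUc : ∀ x ∈ N', x ∈ U' → c x = 0 := fun x hx hxU ↦ by
    rw [hN'def, Subgroup.mem_subgroupOf] at hx
    rw [hcN _ hx]
    exact hUφ₀ _ hx (Subgroup.mem_subgroupOf.mp hxU).1
  -- decompositions of `γ^{t₀}` and `γ^t`
  set t := orderOf (QuotientGroup.mk (s := N' ⊔ U') γ') with htdef
  have htpos : 0 < t := (exists_decomp_subgroupOf κ hH hN hγH hγ U hUopen 1).1
  have hγt₀mem : γ' ^ t₀ ∈ N' ⊔ U₀' := by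
    rw [← QuotientGroup.eq_one_iff, QuotientGroup.mk_pow, ht₀def]
    exact pow_orderOf_eq_one _
  have hγtmem : γ' ^ t ∈ N' ⊔ U' := by
    rw [← QuotientGroup.eq_one_iff, QuotientGroup.mk_pow, htdef]
    exact pow_orderOf_eq_one _
  obtain ⟨n₀, hn₀, u₀, hu₀, h₀⟩ := exists_eq_mul_of_mem_sup_subgroupOf U₀.toSubgroup hγt₀mem
  obtain ⟨nt, hnt, ut, hut, hγt⟩ := exists_eq_mul_of_mem_sup_subgroupOf U hγtmem
  -- `t = t₀ j` with `p ∣ j`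
  have hUU₀ : U' ≤ U₀' := fun u hu ↦
    Subgroup.mem_subgroupOf.mpr (Subgroup.mem_subgroupOf.mp hu).1
  have ht₀t : t₀ ∣ t := by
    rw [ht₀def, orderOf_dvd_iff_pow_eq_one, ← QuotientGroup.mk_pow, QuotientGroup.eq_one_iff]
    exact sup_le_sup_left hUU₀ _ hγtmem
  obtain ⟨j, hj⟩ := ht₀t
  have hpj : p ∣ j := by
    have h1 : p ^ (v + 1) ∣ t :=
      pow_dvd_orderOf_subgroupOf κ hN' hγH hγ U inf_le_right
    rw [hj, ht₀, pow_succ, mul_assoc] at h1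
    have h2 : p ∣ t₀' * j := Nat.dvd_of_mul_dvd_mul_left (pow_pos hp.pos v) h1
    exact Nat.Coprime.dvd_of_dvd_mul_left ((Nat.Prime.coprime_iff_not_dvd hp).mpr ht₀') h2
  -- the obstruction `ob = c n₀ - s_{t₀}` is `N'`-fixed and `γ^{t₀}`-fixed
  set ob := c n₀ - sPow γ' m t₀ with hob
  have hobN : ∀ h ∈ N', h • ob = ob := by
    intro h hh
    have k1 := conjTwist_pow (N := N') γ' m hstar t₀ h hh
    have k2 : conjTwist (γ' ^ t₀) c h = c h + cob (c n₀) h := by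
      rw [h₀, conjTwist_mul]
      rw [conjTwist_congr N' n₀ (hc.conjTwist_of_trivial U₀' hUM₀' hUc₀ hu₀) h hh]
      exact hc.conjTwist_of_mem hn₀ h hh
    rw [k2, add_right_inj, cob_apply, cob_apply] at k1
    rw [hob, smul_sub]
    exact sub_eq_sub_iff_sub_eq_sub.mp k1
  have hobγ : ∀ a : ℕ, γ' ^ (t₀ * a) • ob = ob := by
    intro a
    induction a with
    | zero => simp
    | succ a ih => rw [Nat.mul_succ, pow_add, mul_smul, h₀, mul_smul, hUM₀' _ hu₀, hobN _ hn₀, ih]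
  -- iterated decomposition of `γ^{t₀ i}` at level `U₀`
  have hiter : ∀ i : ℕ, ∃ ni ∈ N', ∃ ui ∈ U₀', γ' ^ (t₀ * i) = ni * ui ∧
      c ni = ∑ a ∈ Finset.range i, γ' ^ (t₀ * a) • c n₀ := by
    intro i
    induction i with
    | zero => exact ⟨1, Subgroup.one_mem _, 1, Subgroup.one_mem _, by simp, by simp [hc.map_one]⟩
    | succ i ih =>
      obtain ⟨ni, hni, ui, hui, hγi, hci⟩ := ih
      have hconj : ui * n₀ * ui⁻¹ ∈ N' := by
        simpa using Subgroup.Normal.conj_mem inferInstance n₀ hn₀ ui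
      refine ⟨ni * (ui * n₀ * ui⁻¹), Subgroup.mul_mem _ hni hconj, ui * u₀, Subgroup.mul_mem _ hui hu₀,
        ?_, ?_⟩
      · rw [Nat.mul_succ, pow_add, hγi, h₀]; group
      · rw [hc _ hni _ hconj, hc.apply_conj_of_trivial U₀' hUM₀' hUc₀ hui hn₀, hci,
          Finset.sum_range_succ]
        congr 1
        have : ni = γ' ^ (t₀ * i) * ui⁻¹ := by rw [hγi]; group
        rw [this, mul_smul, hUM₀' _ (Subgroup.inv_mem _ hui)]
  obtain ⟨nj, hnj, uj, huj, hγj, hcj⟩ := hiter j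
  -- **vanishing of the obstruction at level `U`**: `c n_t = s_t`
  have hkey : c nt = sPow γ' m t := by
    have e1 : c nt = c nj := by
      refine hc.apply_eq_of_mul_mem U₀' hUc₀ hnt hnj ?_
      have : nj⁻¹ * nt = uj * ut⁻¹ := by
        have e : nj * uj = nt * ut := by rw [← hγj, ← hj, ← hγt]
        calc nj⁻¹ * nt = nj⁻¹ * (nt * ut) * ut⁻¹ := by group
          _ = nj⁻¹ * (nj * uj) * ut⁻¹ := by rw [e]
          _ = uj * ut⁻¹ := by group
      rw [this]
      exact Subgroup.mul_mem _ huj (Subgroup.inv_mem _ (hUU₀ hut))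
    rw [e1, hcj, hj, sPow_mul]
    have e2 : ∀ a, γ' ^ (t₀ * a) • c n₀ = ob + γ' ^ (t₀ * a) • sPow γ' m t₀ := fun a ↦ by
      rw [show c n₀ = ob + sPow γ' m t₀ by rw [hob, sub_add_cancel], smul_add, hobγ]
    simp_rw [e2, Finset.sum_add_distrib, Finset.sum_const, Finset.card_range]
    obtain ⟨j', rfl⟩ := hpj
    rw [mul_comm p j', mul_smul, hpM, smul_zero, zero_add]
  -- the extension data
  let D : ExtData N' U' γ' m c :=
    { t := t
      t_pos := htpos
      nt := nt
      ut := ut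
      nt_mem := hnt
      ut_mem := hut
      pow_t := hγt
      key := hkey
      dvd_of_mem := fun d n u hn hu e ↦ by
        rw [htdef, orderOf_dvd_iff_pow_eq_one, ← QuotientGroup.mk_pow, QuotientGroup.eq_one_iff, e]
        exact Subgroup.mul_mem _ (Subgroup.mem_sup_left hn) (Subgroup.mem_sup_right hu)
      cover := fun g ↦ (exists_decomp_subgroupOf κ hH hN hγH hγ U hUopen g).2 }
  -- the extended cocycle is continuous (right-`U'`-invariant, `U'` open in `H`)
  have hcont : Continuous (ext D) := by
    refine IsLocallyConstant.continuous ((IsLocallyConstant.iff_eventually_eq _).mpr fun g ↦ ?_)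
    have hopen : IsOpen ((fun g' ↦ g⁻¹ * g') ⁻¹' (U' : Set H)) :=
      hU'open.preimage (continuous_const_mul g⁻¹)
    refine Filter.eventually_of_mem (hopen.mem_nhds (by simp [U'.one_mem])) fun g' hg' ↦ ?_
    have e : g' = g * (g⁻¹ * g') := by group
    rw [e, ext_mul_of_mem hc hUM hUc D g hg']
  let Φ : contOneCocycles (discreteTopRep H M) :=
    ⟨⟨ext D, hcont⟩, fun g h ↦ ext_mul hc hUM hUc hstar D g h⟩
  refine ⟨oneCocycleClass _ Φ, ?_⟩
  have hres : resOfLe M hNH (oneCocycleClass _ Φ) = oneCocycleClass _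
      (contOneCocycles.pullback (subgroupInclusion hNH)
        (resHomOfEquivariant (subgroupInclusion hNH) (AddMonoidHom.id M) (fun _ _ ↦ rfl)) Φ) :=
    map_oneCocycleClass _ _ _ Φ
  rw [hres]
  congr 1
  apply Subtype.ext
  ext h
  rw [contOneCocycles.pullback_apply]
  change ext D (subgroupInclusion hNH h) = φ.1 h
  have hmem : subgroupInclusion hNH h ∈ N' := Subgroup.mem_subgroupOf.mpr h.2
  rw [ext_of_mem hc hUM hUc D hmem, hcN _ h.2]
  rfl

/-! ### §4. The kernel of the restriction along a procyclic step is finite -/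

/-- **`ker (res : H¹(H, M) → H¹(N, M))` is finite** for `H ≤ Γ_K` closed, `N = H ⊓ ker κ` (normal in
`Γ_K`), `γ ∈ H` with `κ γ = 1` and `M` finite discrete with continuous action: a class dying on `N` has a
representative `δ` with `δ|_N = ∂b|_N`, and `δ − ∂b` is a crossed homomorphism vanishing on `N` — so
determined by its value at `γ` (its zero set is a closed subgroup of `H` containing `N` and `γ`, i.e. `H`,
§1); hence `y ↦ (δ(γ) − (γ b − b))` injects the kernel into `M`. (`ker res = H¹(H/N, M^N)` with `H/N ≅ ℤ_p`
procyclic, Serre I.§2.6 (b); `H¹(ℤ_p, A) ≅ A/(γ−1)A` for finite `A`.) [cite: SerreGaloisCohomology1997, I.§2.6 (b)]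
[cite: GreenbergLNM1716, §3 Lemma 3.1] -/
theorem finite_setOf_resOfLe_eq_zero [Finite M] [ContinuousSMul (Field.absoluteGaloisGroup K) M]
    (hH : IsClosed (H : Set (Field.absoluteGaloisGroup K))) (hNH : N ≤ H)
    (hN : ∀ g ∈ H, κ g = 1 → g ∈ N) (hγH : γ ∈ H) (hγ : κ.IsTopGenerator γ) :
    Set.Finite {y : subgroupH1 H M | resOfLe M hNH y = 0} := by
  classical
  set γ' : H := ⟨γ, hγH⟩ with hγ'def
  -- representatives and the restriction on cocycles
  have hrep : ∀ y : subgroupH1 H M, ∃ ψ : contOneCocycles (discreteTopRep H M), oneCocycleClass _ ψ = y :=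
    fun y ↦ oneCocycleClass_surjective _ y
  choose rep hrep using hrep
  have hres : ∀ ψ : contOneCocycles (discreteTopRep H M), resOfLe M hNH (oneCocycleClass _ ψ) =
      oneCocycleClass _ (contOneCocycles.pullback (subgroupInclusion hNH)
        (resHomOfEquivariant (subgroupInclusion hNH) (AddMonoidHom.id M) (fun _ _ ↦ rfl)) ψ) :=
    fun ψ ↦ map_oneCocycleClass _ _ _ ψ
  have hex : ∀ y : subgroupH1 H M, resOfLe M hNH y = 0 →
      ∃ a : M, ∀ n : N, (rep y).1 (subgroupInclusion hNH n) = (n : Field.absoluteGaloisGroup K) • a - a := by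
    intro y hy
    rw [← hrep y, hres, oneCocycleClass_eq_zero_iff] at hy
    obtain ⟨a, ha⟩ := hy
    refine ⟨a, fun n ↦ ?_⟩
    have := ha n
    rw [contOneCocycles.pullback_apply] at this
    exact this
  -- the invariant `F y = δ(γ) - (γ a - a)`
  let F : subgroupH1 H M → M := fun y ↦
    if hy : resOfLe M hNH y = 0 then
      (rep y).1 γ' - (γ • Classical.choose (hex y hy) - Classical.choose (hex y hy)) else 0
  refine Set.Finite.of_finite_image (f := F) (Set.toFinite _) ?_
  intro y₁ hy₁ y₂ hy₂ hF
  simp only [Set.mem_setOf_eq] at hy₁ hy₂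
  have hF' : (rep y₁).1 γ' - (γ • Classical.choose (hex y₁ hy₁) - Classical.choose (hex y₁ hy₁)) =
      (rep y₂).1 γ' - (γ • Classical.choose (hex y₂ hy₂) - Classical.choose (hex y₂ hy₂)) := by
    simpa only [F, dif_pos hy₁, dif_pos hy₂] using hF
  set a₁ := Classical.choose (hex y₁ hy₁) with ha₁def
  set a₂ := Classical.choose (hex y₂ hy₂) with ha₂def
  have ha₁ := Classical.choose_spec (hex y₁ hy₁)
  have ha₂ := Classical.choose_spec (hex y₂ hy₂)
  rw [← ha₁def] at ha₁
  rw [← ha₂def] at ha₂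
  -- `δ = rep y₁ - rep y₂`, `b = a₁ - a₂`
  set b := a₁ - a₂ with hb
  set δ : contOneCocycles (discreteTopRep H M) := rep y₁ - rep y₂ with hδ
  clear_value b δ
  have hδapply : ∀ h : H, δ.1 h = (rep y₁).1 h - (rep y₂).1 h := fun h ↦ by
    rw [hδ, Submodule.coe_sub, ContinuousMap.sub_apply]
  have hδN : ∀ n : N, δ.1 (subgroupInclusion hNH n) = (n : Field.absoluteGaloisGroup K) • b - b := by
    intro n
    rw [hδapply, ha₁, ha₂, hb, smul_sub]
    abel
  have hδγ : δ.1 γ' = γ • b - b := by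
    rw [hδapply, hb, smul_sub]
    rw [sub_eq_sub_iff_sub_eq_sub] at hF'
    rw [hF']
    abel
  -- the zero set of `δ - ∂b` as a closed subgroup of `H` containing `N'` and `γ'`
  have hcoc : ∀ g h : H, δ.1 (g * h) = δ.1 g + (g : Field.absoluteGaloisGroup K) • δ.1 h :=
    fun g h ↦ δ.2 g h
  let Z : Subgroup H :=
    { carrier := {h | δ.1 h = (h : Field.absoluteGaloisGroup K) • b - b}
      mul_mem' := fun {g h} hg hh ↦ by
        simp only [Set.mem_setOf_eq] at hg hh ⊢
        rw [hcoc, hg, hh, Subgroup.coe_mul, mul_smul,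
          smul_sub (g : Field.absoluteGaloisGroup K) ((h : Field.absoluteGaloisGroup K) • b) b]
        abel
      one_mem' := by
        simp only [Set.mem_setOf_eq, Subgroup.coe_one, one_smul, sub_self]
        exact contOneCocycles.apply_one δ
      inv_mem' := fun {h} hh ↦ by
        simp only [Set.mem_setOf_eq] at hh ⊢
        have h1 := hcoc h⁻¹ h
        rw [inv_mul_cancel, contOneCocycles.apply_one, hh] at h1
        rw [Subgroup.coe_inv] at h1 ⊢
        rw [smul_sub (h : Field.absoluteGaloisGroup K)⁻¹ ((h : Field.absoluteGaloisGroup K) • b) b,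
          smul_smul, inv_mul_cancel, one_smul] at h1
        have h2 := eq_neg_of_add_eq_zero_left h1.symm
        rw [h2]
        abel }
  have hZclosed : IsClosed (Z : Set H) := by
    have hcontf : Continuous fun h : H ↦ δ.1 h - ((h : Field.absoluteGaloisGroup K) • b - b) :=
      δ.1.continuous.sub ((continuous_subtype_val.smul continuous_const).sub continuous_const)
    have e : (Z : Set H) =
        (fun h : H ↦ δ.1 h - ((h : Field.absoluteGaloisGroup K) • b - b)) ⁻¹' {0} := by
      ext h
      rw [Set.mem_preimage, Set.mem_singleton_iff, sub_eq_zero]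
      rfl
    rw [e]
    exact (isClosed_discrete ({0} : Set M)).preimage hcontf
  have hNZ : N.subgroupOf H ≤ Z := by
    intro h hh
    rw [Subgroup.mem_subgroupOf] at hh
    have := hδN ⟨h, hh⟩
    exact this
  have hγZ : γ' ∈ Z := hδγ
  have hZtop : Z = ⊤ := subgroup_eq_top_of_isClosed κ hH hN hγH hγ Z hZclosed hNZ hγZ
  have hall : ∀ h : H, δ.1 h = (h : Field.absoluteGaloisGroup K) • b - b := fun h ↦ by
    have : h ∈ Z := hZtop ▸ Subgroup.mem_top h
    exact this
  -- conclusion: `[δ] = 0`, so `y₁ = y₂`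
  have hzero : oneCocycleClass _ δ = 0 := (oneCocycleClass_eq_zero_iff _ δ).mpr ⟨b, hall⟩
  rw [hδ, oneCocycleClass_sub, hrep, hrep, sub_eq_zero] at hzero
  exact hzero

end Relative

end ZpDescent

end Literature.NumberTheory.EllipticCurves
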